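import Literature.MathematicalPhysics.QuantumFieldTheory.Balaban1983to89.Node00.N24NodesStage13FourPinPointedAtLive
import Literature.MathematicalPhysics.QuantumFieldTheory.Balaban1983to89.B16RLeafRecord13AtLive

/-!
# NODE N24 · ITEM K1‴'s θ-KEYED CONSEQUENT AND RUNG BODY AT node00-def-K0a's WITNESS OF RECORD `theta13LiveOfRecord F N` — every θ-level slot a THEOREM there:
# `Admissible` (`admissible_theta13LiveOfRecord`), the guard (`ztUnity_theta13LiveOfRecord`, `slotsNondegenerate₁₃_theta13LiveOfRecord` FROM `Provisos₁₃`), N13's 𝐑-half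
# (R₁₃) (dag-n11-e's `B16RLeafRecord13AtLive.laws₁₃_theta13LiveOfRecord_of_provisos` FROM `Provisos₁₃`); what remains is `Provisos₁₃` at the witness (K0‴ 19909's two
# registered clauses), the bound world, the children N05–N12 at their leaves, N13's (UV₁₃), and the β-box pair

TRACK A (YM-PLAN §2d, node N24 of 28 = binder B2), seat `pub-ymgap-dag-n24-c` (R134 fan-out seat, strategy s2; gen 3).  FORTY-SECOND N24 module, a NEW importing one (imports module 41
`N24NodesStage13FourPinPointedAtLive` and dag-n11-e's `B16RLeafRecord13AtLive`).  THEOREMS ONLY, def-free, sorry-free, standard axioms.  Route rev 16: item K1‴ `StabilityBAtRecordR13e`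
(stmt-QuantumFields-19910); K0‴ `Record13Inhabited` (stmt-QuantumFields-19909) is registered AT THIS WITNESS (plan g66 `K0Skeleton13Live.lean`: `(theta13LiveOfRecord F 2).Provisos₁₃ F 2`
from the two ranged clauses of row P11).  Module 34 ∕ 35's `theta12Live` recipe at Stage 13, in the clean instance (the witness OF RECORD carries K0b's residuals of record, so
`ZtUnity` is a theorem with no residual letters displayed).

WHAT THIS FILE PROVES (general `N`; N24 is COMPOSITE — every hypothesis list is «which child blocks AT THE WITNESS OF RECORD», nothing is discharged as a node).
§1 **`N24_stabilityBR13e_thetaShape16_pointed_theta13LiveOfRecord`** ∕ **`N24_stabilityBR13e_thetaShape16_fourPin_pointed_theta13LiveOfRecord`** — K1‴'s θ-keyed consequent witnessed by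
   `(theta13LiveOfRecord F N, hP)`, at the unpinned Stage-13 view (N06 ∕ N07 ∕ N12 at the witness's own layers, N08 in leaf-system form) and over the four-pin view (N08 ← THE PRINTED
   `PrintedUV3V N (theta13LiveOfRecord F N).L`, N06 ∕ N07 ∕ N12 at chosen layers).
§2 **`N24_betaWindowAtSomeRecord₁₃_of_pointed_theta13LiveOfRecord_of_boxH`** ∕ **`N24_betaWindowAtSomeRecord₁₃_of_fourPin_pointed_theta13LiveOfRecord_of_boxH`** — the ∃-body of the
   registered rung `BetaWindowAtSomeRecord13` (hence of `NodesAtSomeRecord13`) witnessed by `(theta13LiveOfRecord F N, hP, w)`.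
WHICH CHILD BLOCKS K1‴ AT THE WITNESS OF RECORD (kernel form) = the hypothesis lists: `hP` (= K0‴) · `hC hγ hL hup` (a bound world — supplied for any letters by module 38's
`N24_exists_boundWorld₁₃` ∕ module 40's `N24_exists_boundWorld₁₃B10YZW`) · N05 [B8] residual leaf at `(theta13LiveOfRecord F N).res.X` · N06 ∕ N07 ∕ N12 leaves · N08 (leaf systems ∕ PRINTED
`PrintedUV3V`) · N09 Lemma-4 leaf + Theorem-3 member · N10 B13 socket · N11 (S1ᵀ) · N13 (UV₁₃) (0.1) pointwise on `densOfRecord₁₃` at the world's own `e₋ ∕ e₊` · the β-box pair on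
`(datumOfRecord₁₃ …).βfun` at `γ₀ := w.γ` ([I] (1.22) p. 264; lower half UNPRINTED, node O).
HONEST FRAMING: kernel bookkeeping BY NAME; nothing of Bałaban's asserted; no discharge, no count moved (5∕27), no stub closed; one finite T⁴ programme at fixed ε; NOT continuum ∕ ℝ⁴ ∕
OS ∕ mass gap ∕ Clay.
-/

noncomputable section

open scoped Matrix.Norms.L2Operator

namespace Literature.MathematicalPhysics.QuantumFieldTheory.Balaban1983to89.Node00

open DagBinding T4Continuum T4DatumAssembly FlowStepRuns AveragingRT
open FlowStep (BetaLowerH BetaUpperH)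
open B16RLeafRecord13AtLive (laws₁₃_theta13LiveOfRecord_of_provisos)

variable {F : T4Family} {N : ℕ} [NeZero N]

/-! ## §1. Item K1‴'s θ-keyed consequent witnessed by the witness of record -/

/-- **★ ITEM K1‴'s θ-KEYED CONSEQUENT WITNESSED BY `(theta13LiveOfRecord F N, hP)` AT THE UNPINNED STAGE-13 VIEW** — `Admissible`, `ZtUnity`, `SlotsNondegenerate₁₃`, N13's (R₁₃) ALL
THEOREMS at the witness (K0a FILE 8, dag-n11-e (A′)); hypotheses = `Provisos₁₃` there + a bound world + the children N05–N12 + N13's (UV₁₃) + the β-box pair.  COMPOSITE.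
[cite: Balaban1989LargeFieldII, Thm 1 p.355, (0.1) pp.355–356, p.391; Balaban1988Convergent, p.244, Thm 2 p.263, (3.16)–(3.22) pp.268–269, (3.24)–(3.25) p.270; Balaban1989LargeFieldI, (0.2)–(0.4) p.176; Balaban1987RG1, Thm 3 p.264, (0.17)–(0.21) pp.255–256 and (1.22) p.264 (bookkeeping + elementary window)] -/
theorem N24_stabilityBR13e_thetaShape16_pointed_theta13LiveOfRecord (hP : (theta13LiveOfRecord F N).Provisos₁₃ F N) (w : WorldP)
    (hC : w.C = (datumOfRecord₁₃ F N (theta13LiveOfRecord F N) hP).C) (hγ : 0 < w.γ ∧ w.γ ≤ (theta13LiveOfRecord F N).γ) (hL : w.L = ((theta13LiveOfRecord F N).L : ℝ))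
    (hup : ∀ P, w.up P = upOfRecord₅C F N ((theta13LiveOfRecord F N).toStage5₁₃ F N) P)
    (h05 : ∀ P : B12.RunParams,
      B8LeafR ((theta13LiveOfRecord F N).res.X P).d8 ((theta13LiveOfRecord F N).res.X P).L8 ((theta13LiveOfRecord F N).res.X P).C₂ ((theta13LiveOfRecord F N).res.X P).B₁' ((theta13LiveOfRecord F N).res.X P).B₀' ((theta13LiveOfRecord F N).res.X P).B₁ ((theta13LiveOfRecord F N).res.X P).B₂ ((theta13LiveOfRecord F N).res.X P).c₁
        ((theta13LiveOfRecord F N).res.X P).inp8 ((theta13LiveOfRecord F N).res.X P).B₀β ((theta13LiveOfRecord F N).res.X P).loc8 ((theta13LiveOfRecord F N).res.X P).fam8R ((theta13LiveOfRecord F N).res.X P).lan8 ((theta13LiveOfRecord F N).res.X P).cub8 ((theta13LiveOfRecord F N).res.X P).toAxial8)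
    (h06 : ∀ P : B12.RunParams, B9LeafX ((theta13LiveOfRecord F N).res.Y P))
    (h07 : ∀ P : B12.RunParams, B11Leaf ((theta13LiveOfRecord F N).res.Z P))
    (h08 : ∀ P : B12.RunParams, ∃ (Xc : PrintedCarriersR) (I : Type) (C : B10Assembly.Consts) (T : I → B10.TowerRun),
      Nonempty (∀ i, B10Assembly.LeafSystem C (T i)) ∧ (theta13LiveOfRecord F N).res.X P = Xc.withTowerRuns10 T)
    (h09 : ∀ P : B12.RunParams, B12Sec2to5.Lemma4Printed ((theta13LiveOfRecord F N).res.X P).F12 ((theta13LiveOfRecord F N).res.X P).c12)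
    (h09T : ∀ P : B12.RunParams, (leavesP w P).smallCouplings → (leavesP w P).smallFieldInductive)
    (h10 : ∀ P : B12.RunParams, B9LeafX ((theta13LiveOfRecord F N).res.Y P) →
      (B10.Thm1PrintedCompact ((theta13LiveOfRecord F N).res.X P).runs10 ∧ B10.Thm2Printed ((theta13LiveOfRecord F N).res.X P).runs10) →
        B11Leaf ((theta13LiveOfRecord F N).res.Z P) → B12Sec2to5.Lemma4Printed ((theta13LiveOfRecord F N).res.X P).F12 ((theta13LiveOfRecord F N).res.X P).c12 →
          B13.Lemma1Printed ((theta13LiveOfRecord F N).res.X P).S13 ((theta13LiveOfRecord F N).res.X P).c13 ∧ B13.Lemma2Printed ((theta13LiveOfRecord F N).res.X P).S13 ((theta13LiveOfRecord F N).res.X P).c13 ∧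
            B13.Lemma3Printed ((theta13LiveOfRecord F N).res.X P).S13 ((theta13LiveOfRecord F N).res.X P).c13)
    (h11 : ∀ P : B12.RunParams, (leavesP w P).b7 → (leavesP w P).b8 → (leavesP w P).b9 → (leavesP w P).b10 → (leavesP w P).b11 →
      (leavesP w P).smallCouplings → (leavesP w P).smallFieldInductive → (leavesP w P).flowControl →
        ∀ k, k < P.K → SLaw₁₃ F N (theta13LiveOfRecord F N) P k → TLaw₁₃ F N (theta13LiveOfRecord F N) P k)
    (h12 : ∀ P : B12.RunParams, B15Leaf ((theta13LiveOfRecord F N).res.W P))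
    (hUV : ∀ P : B12.RunParams, (genFlow (betaOfRecord₁₃ F N (theta13LiveOfRecord F N)) P.g0).InInterval w.γ P.K → ∀ k, k ≤ P.K → SLaw₁₃ F N (theta13LiveOfRecord F N) P k →
      ∀ U : GaugeField (F.P P.K) k (SU N),
        chiβOfRecord₁₃ F N (theta13LiveOfRecord F N) P.K (gOfRecord₁₃ F N (theta13LiveOfRecord F N) P) k U *
              Real.exp (-(1 / (gOfRecord₁₃ F N (theta13LiveOfRecord F N) P k) ^ 2 * wilsonBGOfRecord F N (theta13LiveOfRecord F N).εbg P k U)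
                - w.em (gOfRecord₁₃ F N (theta13LiveOfRecord F N) P k) * (Fintype.card (Site (F.P P.K) k) : ℝ)) ≤ densOfRecord₁₃ F N (theta13LiveOfRecord F N) P k U ∧
        densOfRecord₁₃ F N (theta13LiveOfRecord F N) P k U ≤ Real.exp (w.ep (gOfRecord₁₃ F N (theta13LiveOfRecord F N) P k) * (Fintype.card (Site (F.P P.K) k) : ℝ)))
    (hlo : BetaLowerH w.b w.γ (datumOfRecord₁₃ F N (theta13LiveOfRecord F N) hP).βfun) (hhi : BetaUpperH w.βup w.γ (datumOfRecord₁₃ F N (theta13LiveOfRecord F N) hP).βfun) :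
    ∃ (θ' : Stage13Params F N) (h' : θ'.Provisos₁₃ F N), (θ'.ZtUnity F N ∧ θ'.SlotsNondegenerate₁₃ F N) ∧ θ'.Admissible F N ∧
      B16.EndStatementBPrinted (datumOfRecord₁₃ F N θ' h').C ∧
      ∃ γ₁ : ℝ, 0 < γ₁ ∧ ∀ γ : ℝ, 0 < γ → γ ≤ γ₁ → ∃ P : B12.RunParams, 1 ≤ P.K ∧ ((datumOfRecord₁₃ F N θ' h').C P).flow.InInterval γ P.K :=
  N24_stabilityBR13e_thetaShape16_pointed (theta13LiveOfRecord F N) hP (admissible_theta13LiveOfRecord F N)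
    ⟨ztUnity_theta13LiveOfRecord F N, slotsNondegenerate₁₃_theta13LiveOfRecord F N hP⟩ w hC hγ hL hup h05 h06 h07 h08 h09 h09T h10 h11 h12
    (fun P k hk => laws₁₃_theta13LiveOfRecord_of_provisos F N P hP k hk) hUV hlo hhi

/-- **★ ITEM K1‴'s θ-KEYED CONSEQUENT WITNESSED BY `(theta13LiveOfRecord F N, hP)` OVER THE FOUR-PIN VIEW** (N08 ← THE PRINTED `PrintedUV3V N (theta13LiveOfRecord F N).L`; N06 ∕ N07 ∕ N12 at
the chosen layers `(M⋆, ops)`, `ζ`, `λW`).  COMPOSITE.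
[cite: Balaban1989LargeFieldII, Thm 1 p.355, (0.1) pp.355–356, p.391; Balaban1988Convergent, p.244, Thm 2 p.263, (3.16)–(3.22) pp.268–269; Balaban1989LargeFieldI, (0.2)–(0.4) p.176; Balaban1987RG1, Thm 3 p.264, (0.17)–(0.21) pp.255–256 and (1.22) p.264; Balaban1985UV3, Thm 1 p.257 + Thm 2 p.272 (bookkeeping + elementary window)] -/
theorem N24_stabilityBR13e_thetaShape16_fourPin_pointed_theta13LiveOfRecord (hP : (theta13LiveOfRecord F N).Provisos₁₃ F N)
    (Mstar : ℕ) (ops : OpsY N (theta13LiveOfRecord F N).toStage3Params Mstar) (ζ : ResidZ F N) (lamW : ResidW F N) (w : WorldP)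
    (hC : w.C = (datumOfRecord₁₃ F N (theta13LiveOfRecord F N) hP).C) (hγ : 0 < w.γ ∧ w.γ ≤ (theta13LiveOfRecord F N).γ) (hL : w.L = ((theta13LiveOfRecord F N).L : ℝ))
    (hup : ∀ P, w.up P = upOfRecord₅C F N ((theta13LiveOfRecord F N).view₁₃B10YZW F N Mstar ops ζ lamW) P)
    (h05 : ∀ P : B12.RunParams,
      B8LeafR ((theta13LiveOfRecord F N).res.X P).d8 ((theta13LiveOfRecord F N).res.X P).L8 ((theta13LiveOfRecord F N).res.X P).C₂ ((theta13LiveOfRecord F N).res.X P).B₁' ((theta13LiveOfRecord F N).res.X P).B₀' ((theta13LiveOfRecord F N).res.X P).B₁ ((theta13LiveOfRecord F N).res.X P).B₂ ((theta13LiveOfRecord F N).res.X P).c₁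
        ((theta13LiveOfRecord F N).res.X P).inp8 ((theta13LiveOfRecord F N).res.X P).B₀β ((theta13LiveOfRecord F N).res.X P).loc8 ((theta13LiveOfRecord F N).res.X P).fam8R ((theta13LiveOfRecord F N).res.X P).lan8 ((theta13LiveOfRecord F N).res.X P).cub8 ((theta13LiveOfRecord F N).res.X P).toAxial8)
    (h06 : B9LeafX (Y9OfRecord N (theta13LiveOfRecord F N).toStage3Params Mstar ops))
    (h07 : B11Leaf (Z11OfRecord F N ζ))
    (h08 : PrintedUV3V N (theta13LiveOfRecord F N).L)
    (h09 : ∀ P : B12.RunParams, B12Sec2to5.Lemma4Printed ((theta13LiveOfRecord F N).res.X P).F12 ((theta13LiveOfRecord F N).res.X P).c12)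
    (h09T : ∀ P : B12.RunParams, (leavesP w P).smallCouplings → (leavesP w P).smallFieldInductive)
    (h10 : ∀ P : B12.RunParams, B9LeafX (Y9OfRecord N (theta13LiveOfRecord F N).toStage3Params Mstar ops) →
      (B10.Thm1PrintedCompact (((theta13LiveOfRecord F N).view₁₃B10YZW F N Mstar ops ζ lamW).res.X P).runs10 ∧
          B10.Thm2Printed (((theta13LiveOfRecord F N).view₁₃B10YZW F N Mstar ops ζ lamW).res.X P).runs10) →
        B11Leaf (Z11OfRecord F N ζ) → B12Sec2to5.Lemma4Printed ((theta13LiveOfRecord F N).res.X P).F12 ((theta13LiveOfRecord F N).res.X P).c12 →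
          B13.Lemma1Printed ((theta13LiveOfRecord F N).res.X P).S13 ((theta13LiveOfRecord F N).res.X P).c13 ∧ B13.Lemma2Printed ((theta13LiveOfRecord F N).res.X P).S13 ((theta13LiveOfRecord F N).res.X P).c13 ∧
            B13.Lemma3Printed ((theta13LiveOfRecord F N).res.X P).S13 ((theta13LiveOfRecord F N).res.X P).c13)
    (h11 : ∀ P : B12.RunParams, (leavesP w P).b7 → (leavesP w P).b8 → (leavesP w P).b9 → (leavesP w P).b10 → (leavesP w P).b11 →
      (leavesP w P).smallCouplings → (leavesP w P).smallFieldInductive → (leavesP w P).flowControl →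
        ∀ k, k < P.K → SLaw₁₃ F N (theta13LiveOfRecord F N) P k → TLaw₁₃ F N (theta13LiveOfRecord F N) P k)
    (h12 : ∀ P : B12.RunParams, B15Leaf (WOfRecord₁₃ F N (theta13LiveOfRecord F N) lamW P))
    (hUV : ∀ P : B12.RunParams, (genFlow (betaOfRecord₁₃ F N (theta13LiveOfRecord F N)) P.g0).InInterval w.γ P.K → ∀ k, k ≤ P.K → SLaw₁₃ F N (theta13LiveOfRecord F N) P k →
      ∀ U : GaugeField (F.P P.K) k (SU N),
        chiβOfRecord₁₃ F N (theta13LiveOfRecord F N) P.K (gOfRecord₁₃ F N (theta13LiveOfRecord F N) P) k U *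
              Real.exp (-(1 / (gOfRecord₁₃ F N (theta13LiveOfRecord F N) P k) ^ 2 * wilsonBGOfRecord F N (theta13LiveOfRecord F N).εbg P k U)
                - w.em (gOfRecord₁₃ F N (theta13LiveOfRecord F N) P k) * (Fintype.card (Site (F.P P.K) k) : ℝ)) ≤ densOfRecord₁₃ F N (theta13LiveOfRecord F N) P k U ∧
        densOfRecord₁₃ F N (theta13LiveOfRecord F N) P k U ≤ Real.exp (w.ep (gOfRecord₁₃ F N (theta13LiveOfRecord F N) P k) * (Fintype.card (Site (F.P P.K) k) : ℝ)))
    (hlo : BetaLowerH w.b w.γ (datumOfRecord₁₃ F N (theta13LiveOfRecord F N) hP).βfun) (hhi : BetaUpperH w.βup w.γ (datumOfRecord₁₃ F N (theta13LiveOfRecord F N) hP).βfun) :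
    ∃ (θ' : Stage13Params F N) (h' : θ'.Provisos₁₃ F N), (θ'.ZtUnity F N ∧ θ'.SlotsNondegenerate₁₃ F N) ∧ θ'.Admissible F N ∧
      B16.EndStatementBPrinted (datumOfRecord₁₃ F N θ' h').C ∧
      ∃ γ₁ : ℝ, 0 < γ₁ ∧ ∀ γ : ℝ, 0 < γ → γ ≤ γ₁ → ∃ P : B12.RunParams, 1 ≤ P.K ∧ ((datumOfRecord₁₃ F N θ' h').C P).flow.InInterval γ P.K :=
  N24_stabilityBR13e_thetaShape16_fourPin_pointed (theta13LiveOfRecord F N) hP (admissible_theta13LiveOfRecord F N)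
    ⟨ztUnity_theta13LiveOfRecord F N, slotsNondegenerate₁₃_theta13LiveOfRecord F N hP⟩ Mstar ops ζ lamW w hC hγ hL hup h05 h06 h07 h08 h09 h09T h10 h11 h12
    (fun P k hk => laws₁₃_theta13LiveOfRecord_of_provisos F N P hP k hk) hUV hlo hhi

/-! ## §2. The rung body `BetaWindowAtSomeRecord13` witnessed by the witness of record -/

/-- **THE ∃-BODY OF `BetaWindowAtSomeRecord13` WITNESSED BY `(theta13LiveOfRecord F N, hP, w)` AT THE UNPINNED VIEW** — THE HYPOTHESIS LIST IS «WHICH CHILD BLOCKS `stub_betaWindow13` (and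
`stub_nodes13`) AT THE WITNESS OF RECORD». [cite: Balaban1989LargeFieldII, Thm 1 p.355, (0.1) pp.355–356, p.391; Balaban1988Convergent, p.244, Thm 2 p.263; Balaban1987RG1, Thm 3 p.264, (0.17)–(0.21) pp.255–256 and (1.22) p.264 (bookkeeping + elementary window)] -/
theorem N24_betaWindowAtSomeRecord₁₃_of_pointed_theta13LiveOfRecord_of_boxH (hP : (theta13LiveOfRecord F N).Provisos₁₃ F N)
    (w : WorldP)
    (hC : w.C = (datumOfRecord₁₃ F N (theta13LiveOfRecord F N) hP).C) (hγ : 0 < w.γ ∧ w.γ ≤ (theta13LiveOfRecord F N).γ) (hL : w.L = ((theta13LiveOfRecord F N).L : ℝ))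
    (hup : ∀ P, w.up P = upOfRecord₅C F N ((theta13LiveOfRecord F N).toStage5₁₃ F N) P)
    (h05 : ∀ P : B12.RunParams,
      B8LeafR ((theta13LiveOfRecord F N).res.X P).d8 ((theta13LiveOfRecord F N).res.X P).L8 ((theta13LiveOfRecord F N).res.X P).C₂ ((theta13LiveOfRecord F N).res.X P).B₁' ((theta13LiveOfRecord F N).res.X P).B₀' ((theta13LiveOfRecord F N).res.X P).B₁ ((theta13LiveOfRecord F N).res.X P).B₂ ((theta13LiveOfRecord F N).res.X P).c₁
        ((theta13LiveOfRecord F N).res.X P).inp8 ((theta13LiveOfRecord F N).res.X P).B₀β ((theta13LiveOfRecord F N).res.X P).loc8 ((theta13LiveOfRecord F N).res.X P).fam8R ((theta13LiveOfRecord F N).res.X P).lan8 ((theta13LiveOfRecord F N).res.X P).cub8 ((theta13LiveOfRecord F N).res.X P).toAxial8)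
    (h06 : ∀ P : B12.RunParams, B9LeafX ((theta13LiveOfRecord F N).res.Y P))
    (h07 : ∀ P : B12.RunParams, B11Leaf ((theta13LiveOfRecord F N).res.Z P))
    (h08 : ∀ P : B12.RunParams, ∃ (Xc : PrintedCarriersR) (I : Type) (C : B10Assembly.Consts) (T : I → B10.TowerRun),
      Nonempty (∀ i, B10Assembly.LeafSystem C (T i)) ∧ (theta13LiveOfRecord F N).res.X P = Xc.withTowerRuns10 T)
    (h09 : ∀ P : B12.RunParams, B12Sec2to5.Lemma4Printed ((theta13LiveOfRecord F N).res.X P).F12 ((theta13LiveOfRecord F N).res.X P).c12)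
    (h09T : ∀ P : B12.RunParams, (leavesP w P).smallCouplings → (leavesP w P).smallFieldInductive)
    (h10 : ∀ P : B12.RunParams, B9LeafX ((theta13LiveOfRecord F N).res.Y P) →
      (B10.Thm1PrintedCompact ((theta13LiveOfRecord F N).res.X P).runs10 ∧ B10.Thm2Printed ((theta13LiveOfRecord F N).res.X P).runs10) →
        B11Leaf ((theta13LiveOfRecord F N).res.Z P) → B12Sec2to5.Lemma4Printed ((theta13LiveOfRecord F N).res.X P).F12 ((theta13LiveOfRecord F N).res.X P).c12 →
          B13.Lemma1Printed ((theta13LiveOfRecord F N).res.X P).S13 ((theta13LiveOfRecord F N).res.X P).c13 ∧ B13.Lemma2Printed ((theta13LiveOfRecord F N).res.X P).S13 ((theta13LiveOfRecord F N).res.X P).c13 ∧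
            B13.Lemma3Printed ((theta13LiveOfRecord F N).res.X P).S13 ((theta13LiveOfRecord F N).res.X P).c13)
    (h11 : ∀ P : B12.RunParams, (leavesP w P).b7 → (leavesP w P).b8 → (leavesP w P).b9 → (leavesP w P).b10 → (leavesP w P).b11 →
      (leavesP w P).smallCouplings → (leavesP w P).smallFieldInductive → (leavesP w P).flowControl →
        ∀ k, k < P.K → SLaw₁₃ F N (theta13LiveOfRecord F N) P k → TLaw₁₃ F N (theta13LiveOfRecord F N) P k)
    (h12 : ∀ P : B12.RunParams, B15Leaf ((theta13LiveOfRecord F N).res.W P))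
    (hUV : ∀ P : B12.RunParams, (genFlow (betaOfRecord₁₃ F N (theta13LiveOfRecord F N)) P.g0).InInterval w.γ P.K → ∀ k, k ≤ P.K → SLaw₁₃ F N (theta13LiveOfRecord F N) P k →
      ∀ U : GaugeField (F.P P.K) k (SU N),
        chiβOfRecord₁₃ F N (theta13LiveOfRecord F N) P.K (gOfRecord₁₃ F N (theta13LiveOfRecord F N) P) k U *
              Real.exp (-(1 / (gOfRecord₁₃ F N (theta13LiveOfRecord F N) P k) ^ 2 * wilsonBGOfRecord F N (theta13LiveOfRecord F N).εbg P k U)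
                - w.em (gOfRecord₁₃ F N (theta13LiveOfRecord F N) P k) * (Fintype.card (Site (F.P P.K) k) : ℝ)) ≤ densOfRecord₁₃ F N (theta13LiveOfRecord F N) P k U ∧
        densOfRecord₁₃ F N (theta13LiveOfRecord F N) P k U ≤ Real.exp (w.ep (gOfRecord₁₃ F N (theta13LiveOfRecord F N) P k) * (Fintype.card (Site (F.P P.K) k) : ℝ)))
    (hlo : BetaLowerH w.b w.γ (datumOfRecord₁₃ F N (theta13LiveOfRecord F N) hP).βfun) (hhi : BetaUpperH w.βup w.γ (datumOfRecord₁₃ F N (theta13LiveOfRecord F N) hP).βfun) :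
    ∃ (θ' : Stage13Params F N) (h' : θ'.Provisos₁₃ F N) (w' : WorldP), (θ'.ZtUnity F N ∧ θ'.SlotsNondegenerate₁₃ F N) ∧ θ'.Admissible F N ∧
      IsRecordOfRecord₁₃C F N (datumOfRecord₁₃ F N θ' h') w' ∧ (∀ P : B12.RunParams, Nodes (leavesP w' P)) ∧
      BetaBoundsInInterval w'.C.toB12 w'.γ w'.b w'.βup ∧
      ∃ γ₁ : ℝ, 0 < γ₁ ∧ ∀ γ : ℝ, 0 < γ → γ ≤ γ₁ → ∃ P : B12.RunParams, 1 ≤ P.K ∧ ((datumOfRecord₁₃ F N θ' h').C P).flow.InInterval γ P.K :=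
  N24_betaWindowAtSomeRecord₁₃_of_pointed_of_boxH (theta13LiveOfRecord F N) hP (admissible_theta13LiveOfRecord F N)
    ⟨ztUnity_theta13LiveOfRecord F N, slotsNondegenerate₁₃_theta13LiveOfRecord F N hP⟩ w hC hγ hL hup h05 h06 h07 h08 h09 h09T h10 h11 h12
    (fun P k hk => laws₁₃_theta13LiveOfRecord_of_provisos F N P hP k hk) hUV hlo hhi

/-- **THE ∃-BODY OF `BetaWindowAtSomeRecord13` WITNESSED BY `(theta13LiveOfRecord F N, hP, w)` OVER THE FOUR-PIN VIEW** (N08 ← the printed `PrintedUV3V`).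
[cite: Balaban1989LargeFieldII, Thm 1 p.355, (0.1) pp.355–356, p.391; Balaban1988Convergent, p.244, Thm 2 p.263; Balaban1987RG1, Thm 3 p.264, (0.17)–(0.21) pp.255–256 and (1.22) p.264; Balaban1985UV3, Thm 1 p.257 (bookkeeping + elementary window)] -/
theorem N24_betaWindowAtSomeRecord₁₃_of_fourPin_pointed_theta13LiveOfRecord_of_boxH (hP : (theta13LiveOfRecord F N).Provisos₁₃ F N)
    (Mstar : ℕ) (ops : OpsY N (theta13LiveOfRecord F N).toStage3Params Mstar) (ζ : ResidZ F N) (lamW : ResidW F N) (w : WorldP)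
    (hC : w.C = (datumOfRecord₁₃ F N (theta13LiveOfRecord F N) hP).C) (hγ : 0 < w.γ ∧ w.γ ≤ (theta13LiveOfRecord F N).γ) (hL : w.L = ((theta13LiveOfRecord F N).L : ℝ))
    (hup : ∀ P, w.up P = upOfRecord₅C F N ((theta13LiveOfRecord F N).view₁₃B10YZW F N Mstar ops ζ lamW) P)
    (h05 : ∀ P : B12.RunParams,
      B8LeafR ((theta13LiveOfRecord F N).res.X P).d8 ((theta13LiveOfRecord F N).res.X P).L8 ((theta13LiveOfRecord F N).res.X P).C₂ ((theta13LiveOfRecord F N).res.X P).B₁' ((theta13LiveOfRecord F N).res.X P).B₀' ((theta13LiveOfRecord F N).res.X P).B₁ ((theta13LiveOfRecord F N).res.X P).B₂ ((theta13LiveOfRecord F N).res.X P).c₁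
        ((theta13LiveOfRecord F N).res.X P).inp8 ((theta13LiveOfRecord F N).res.X P).B₀β ((theta13LiveOfRecord F N).res.X P).loc8 ((theta13LiveOfRecord F N).res.X P).fam8R ((theta13LiveOfRecord F N).res.X P).lan8 ((theta13LiveOfRecord F N).res.X P).cub8 ((theta13LiveOfRecord F N).res.X P).toAxial8)
    (h06 : B9LeafX (Y9OfRecord N (theta13LiveOfRecord F N).toStage3Params Mstar ops))
    (h07 : B11Leaf (Z11OfRecord F N ζ))
    (h08 : PrintedUV3V N (theta13LiveOfRecord F N).L)
    (h09 : ∀ P : B12.RunParams, B12Sec2to5.Lemma4Printed ((theta13LiveOfRecord F N).res.X P).F12 ((theta13LiveOfRecord F N).res.X P).c12)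
    (h09T : ∀ P : B12.RunParams, (leavesP w P).smallCouplings → (leavesP w P).smallFieldInductive)
    (h10 : ∀ P : B12.RunParams, B9LeafX (Y9OfRecord N (theta13LiveOfRecord F N).toStage3Params Mstar ops) →
      (B10.Thm1PrintedCompact (((theta13LiveOfRecord F N).view₁₃B10YZW F N Mstar ops ζ lamW).res.X P).runs10 ∧
          B10.Thm2Printed (((theta13LiveOfRecord F N).view₁₃B10YZW F N Mstar ops ζ lamW).res.X P).runs10) →
        B11Leaf (Z11OfRecord F N ζ) → B12Sec2to5.Lemma4Printed ((theta13LiveOfRecord F N).res.X P).F12 ((theta13LiveOfRecord F N).res.X P).c12 →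
          B13.Lemma1Printed ((theta13LiveOfRecord F N).res.X P).S13 ((theta13LiveOfRecord F N).res.X P).c13 ∧ B13.Lemma2Printed ((theta13LiveOfRecord F N).res.X P).S13 ((theta13LiveOfRecord F N).res.X P).c13 ∧
            B13.Lemma3Printed ((theta13LiveOfRecord F N).res.X P).S13 ((theta13LiveOfRecord F N).res.X P).c13)
    (h11 : ∀ P : B12.RunParams, (leavesP w P).b7 → (leavesP w P).b8 → (leavesP w P).b9 → (leavesP w P).b10 → (leavesP w P).b11 →
      (leavesP w P).smallCouplings → (leavesP w P).smallFieldInductive → (leavesP w P).flowControl →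
        ∀ k, k < P.K → SLaw₁₃ F N (theta13LiveOfRecord F N) P k → TLaw₁₃ F N (theta13LiveOfRecord F N) P k)
    (h12 : ∀ P : B12.RunParams, B15Leaf (WOfRecord₁₃ F N (theta13LiveOfRecord F N) lamW P))
    (hUV : ∀ P : B12.RunParams, (genFlow (betaOfRecord₁₃ F N (theta13LiveOfRecord F N)) P.g0).InInterval w.γ P.K → ∀ k, k ≤ P.K → SLaw₁₃ F N (theta13LiveOfRecord F N) P k →
      ∀ U : GaugeField (F.P P.K) k (SU N),
        chiβOfRecord₁₃ F N (theta13LiveOfRecord F N) P.K (gOfRecord₁₃ F N (theta13LiveOfRecord F N) P) k U *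
              Real.exp (-(1 / (gOfRecord₁₃ F N (theta13LiveOfRecord F N) P k) ^ 2 * wilsonBGOfRecord F N (theta13LiveOfRecord F N).εbg P k U)
                - w.em (gOfRecord₁₃ F N (theta13LiveOfRecord F N) P k) * (Fintype.card (Site (F.P P.K) k) : ℝ)) ≤ densOfRecord₁₃ F N (theta13LiveOfRecord F N) P k U ∧
        densOfRecord₁₃ F N (theta13LiveOfRecord F N) P k U ≤ Real.exp (w.ep (gOfRecord₁₃ F N (theta13LiveOfRecord F N) P k) * (Fintype.card (Site (F.P P.K) k) : ℝ)))
    (hlo : BetaLowerH w.b w.γ (datumOfRecord₁₃ F N (theta13LiveOfRecord F N) hP).βfun) (hhi : BetaUpperH w.βup w.γ (datumOfRecord₁₃ F N (theta13LiveOfRecord F N) hP).βfun) :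
    ∃ (θ' : Stage13Params F N) (h' : θ'.Provisos₁₃ F N) (w' : WorldP), (θ'.ZtUnity F N ∧ θ'.SlotsNondegenerate₁₃ F N) ∧ θ'.Admissible F N ∧
      IsRecordOfRecord₁₃C F N (datumOfRecord₁₃ F N θ' h') w' ∧ (∀ P : B12.RunParams, Nodes (leavesP w' P)) ∧
      BetaBoundsInInterval w'.C.toB12 w'.γ w'.b w'.βup ∧
      ∃ γ₁ : ℝ, 0 < γ₁ ∧ ∀ γ : ℝ, 0 < γ → γ ≤ γ₁ → ∃ P : B12.RunParams, 1 ≤ P.K ∧ ((datumOfRecord₁₃ F N θ' h').C P).flow.InInterval γ P.K :=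
  N24_betaWindowAtSomeRecord₁₃_of_fourPin_pointed_of_boxH (theta13LiveOfRecord F N) hP (admissible_theta13LiveOfRecord F N)
    ⟨ztUnity_theta13LiveOfRecord F N, slotsNondegenerate₁₃_theta13LiveOfRecord F N hP⟩ Mstar ops ζ lamW w hC hγ hL hup h05 h06 h07 h08 h09 h09T h10 h11 h12
    (fun P k hk => laws₁₃_theta13LiveOfRecord_of_provisos F N P hP k hk) hUV hlo hhi

end Literature.MathematicalPhysics.QuantumFieldTheory.Balaban1983to89.Node00

end
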